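import Literature.Geometry.Lorentzian.KerrSchildEnergyEstimate
import Literature.Geometry.Lorentzian.KerrDomainOfDependence
import Summits.FinalStateConjecture.FinalStateConjecture.Theorems.ClusterCompletenessAdiabaticMultiKerrILEDMorawetzBulkDominates
import Summits.FinalStateConjecture.FinalStateConjecture.Theorems.ClusterCompletenessAdiabaticMultiKerrILEDPhotonSphereTimeDeriv
import Summits.FinalStateConjecture.FinalStateConjecture.Theorems.ClusterCompletenessAdiabaticMultiKerrILEDPhotonSphereAngular
import Summits.FinalStateConjecture.FinalStateConjecture.Theorems.ClusterCompletenessAdiabaticMultiKerrILEDZerothOrderTransport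
import Summits.FinalStateConjecture.FinalStateConjecture.Theorems.ClusterCompletenessAdiabaticMultiKerrILEDSlabBookkeeping

/-!
# Route ClusterCompleteness — crux `AdiabaticMultiKerrILED`, line `Sketch`:
# the full space-time gradient on the photon-sphere shell (non-degenerate ILED, step 9b-i)

Helper file for the crux `stmt-FinalStateConjecture-14310`
(`Summit.FinalStateConjecture.FinalStateConjecture.Theses.ClusterCompleteness.AdiabaticMultiKerrILED`),
line `Sketch`, registered stub `restFrame_ILED_photonSphere` (lead c7, wave 9).

Setting: one static tails-cut Schwarzschild zone at zero spin in its rest frame, tilted leaves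
`{x⁰ = u + F(y)}` of slope `≤ 1/2`, `Φ ∈ C³` solving `□_{G₀} Φ = 0` on `{F ≤ x⁰} ∩ {r > 2M}`.
On the photon-sphere shell `5M/2 ≤ r ≤ 7M/2` the energy density splits as
`∑_μ (∂_μΦ)² ≤ 51 (∂₀Φ)² + |∇̸Φ|² + 50 (∂_{r*}Φ)²` (`1 − μ ≥ 1/5` there); the three pieces are
controlled by the landed wave-8 stubs `restFrame_photonSphere_timeDeriv_le` (ψ̇-Hardy),
`restFrame_photonSphere_angular_le` (Lagrangian current), the designed Morawetz bulk
(`morawetzBulk_dominates`) and the zeroth-order transport `restFrame_zerothOrder_le`; the result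
is the slab bound by the seven atoms (degenerate bulks of `Φ` and `∂₀Φ`, collar energy, leaf
energies and leaf `L²` masses at `u = 0, s`). Dafermos–Rodnianski arXiv:0811.0354, §4.1–4.2.
-/

noncomputable section

set_option linter.dupNamespace false

open Set Filter Metric MeasureTheory
open scoped Topology ENNReal BigOperators
open Literature.Geometry.Lorentzian

namespace Summit.FinalStateConjecture.FinalStateConjecture.Theorems

set_option maxHeartbeats 400000 in
/-- **The full space-time gradient on the photon-sphere shell** (crux `AdiabaticMultiKerrILED`,
line `Sketch`, stub `restFrame_ILED_photonSphere`): for `0 < η ≤ M/4` there is `K` with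
`∫_{(0,s]} ∫_{5M/2 ≤ ‖y‖ ≤ 7M/2} ∑_μ(∂_μΦ)² ≤ K (D[Φ] + D[∂₀Φ] + Collar_η + E(0) + E(s) + P(0) + P(s))`
for every admissible `F`, `Φ`, `s ≥ 0` (notation of the statement). Proof: pointwise split
`e ≤ 51 g² + |∇̸Φ|² + 50 K_P 𝔅` on the shell (`photonSphere_energy_split_real`,
`morawetzBulk_dominates`), then the ψ̇-Hardy stub, the angular stub and the zeroth-order stub,
each of whose right-hand sides is re-expressed through the seven atoms (`g² ≤ e ≤ K_P 𝔅` off the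
photon sphere, the commuted bulk `M²(∂_{r*}Φ̇)² + (r−3M)²Φ̈² ≤ K_P(M²+M³)𝔅[Φ̇]`,
`Φ² ≤ K_P M³ 𝔅` on `[15M/2, 9M]`). Dafermos–Rodnianski arXiv:0811.0354, §4. [folklore] -/
theorem restFrame_ILED_photonSphere : ∀ (M η : ℝ), 0 < M → 0 < η → η ≤ M / 4 → ∃ K : NNReal, ∀ (F : E3 → ℝ) (Φ : E4 → ℝ) (s : ℝ), ContDiff ℝ 2 F → (∀ y, ‖fderiv ℝ F y‖ ≤ 2⁻¹) → ContDiff ℝ 3 Φ → (∀ x : E4, F (E4.spatial x) ≤ x 0 → 2 * M < Kerr.radius 0 x → KerrSchild.waveOperator (KerrSchild.inverseMetric (fun y ↦ Real.smoothTransition (2 - Kerr.radius 0 y / (8 * M)) * (2 * Kerr.scalarH M 0 y)) (Kerr.nullVector 0)) Φ x = 0) → 0 ≤ s → ∫⁻ u in Set.Ioc 0 s, ∫⁻ y in {y : E3 | 5 * M / 2 ≤ ‖y‖ ∧ ‖y‖ ≤ 7 * M / 2}, ENNReal.ofReal (∑ μ : Fin 4, fderiv ℝ Φ (E4.ofTimeSpace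 (u + F y) y) (E4.basisVector μ) ^ 2) ≤ (K : ENNReal) * ((∫⁻ u in Set.Ioc 0 s, ∫⁻ y in {y : E3 | 2 * M < ‖y‖}, ENNReal.ofReal ((fun (x : E4) ↦ (((Kerr.radius 0 x - 2 * M) * M ^ 3 * (Kerr.radius 0 x - 3 * M) ^ 2 / (2 * Kerr.radius 0 x ^ 7)) * fderiv ℝ Φ x (E4.basisVector 0) ^ 2 + (3 * M / (20 * Kerr.radius 0 x ^ 2)) * ((1 - (Real.smoothTransition (2 - Kerr.radius 0 x / (8 * M)) * (2 * Kerr.scalarH M 0 x))) * (∑ i : Fin 3, x i.succ * fderiv ℝ Φ x (E4.basisVector i.succ)) / Kerr.radius 0 x + (Real.smoothTransition (2 - Kerr.radius 0 x / (8 * M)) * (2 * Kerr.scalarH M 0 x)) * fderiv ℝ Φ x (E4.basisVector 0)) ^ 2 + ((Kerr.radius 0 x - 3 * M) ^ 2 / (8 * Kerr.radius 0 x ^ 3)) * ((∑ i : Fin 3, fderiv ℝ Φ x (E4.basisVector i.succ) ^ 2) - ((∑ i : Fin 3, x i.succ * fderiv ℝ Φ x (E4.basisVector i.succ)) / Kerr.radius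 0 x) ^ 2) + (if 7 * M ≤ Kerr.radius 0 x then M * (Kerr.radius 0 x - 7 * M) / (4 * Kerr.radius 0 x ^ 5) else 0) * Φ x ^ 2)) (E4.ofTimeSpace (u + F y) y))) + (∫⁻ u in Set.Ioc 0 s, ∫⁻ y in {y : E3 | 2 * M < ‖y‖}, ENNReal.ofReal ((fun (x : E4) ↦ (((Kerr.radius 0 x - 2 * M) * M ^ 3 * (Kerr.radius 0 x - 3 * M) ^ 2 / (2 * Kerr.radius 0 x ^ 7)) * fderiv ℝ (fun z ↦ fderiv ℝ Φ z (E4.basisVector 0)) x (E4.basisVector 0) ^ 2 + (3 * M / (20 * Kerr.radius 0 x ^ 2)) * ((1 - (Real.smoothTransition (2 - Kerr.radius 0 x / (8 * M)) * (2 * Kerr.scalarH M 0 x))) * (∑ i : Fin 3, x i.succ * fderiv ℝ (fun z ↦ fderiv ℝ Φ z (E4.basisVector 0)) x (E4.basisVector i.succ)) / Kerr.radius 0 x + (Real.smoothTransition (2 - Kerr.radius 0 x / (8 * M)) * (2 * Kerr.scalarH M 0 x)) * fderiv ℝ (fun z ↦ fderiv ℝ Φ z (E4.basisVector 0)) x (E4.basisVector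 0)) ^ 2 + ((Kerr.radius 0 x - 3 * M) ^ 2 / (8 * Kerr.radius 0 x ^ 3)) * ((∑ i : Fin 3, fderiv ℝ (fun z ↦ fderiv ℝ Φ z (E4.basisVector 0)) x (E4.basisVector i.succ) ^ 2) - ((∑ i : Fin 3, x i.succ * fderiv ℝ (fun z ↦ fderiv ℝ Φ z (E4.basisVector 0)) x (E4.basisVector i.succ)) / Kerr.radius 0 x) ^ 2) + (if 7 * M ≤ Kerr.radius 0 x then M * (Kerr.radius 0 x - 7 * M) / (4 * Kerr.radius 0 x ^ 5) else 0) * (fun z ↦ fderiv ℝ Φ z (E4.basisVector 0)) x ^ 2)) (E4.ofTimeSpace (u + F y) y))) + (∫⁻ u in Set.Ioc 0 s, ∫⁻ y in {y : E3 | 2 * M < ‖y‖ ∧ ‖y‖ < 2 * M + η}, ENNReal.ofReal (∑ μ : Fin 4, fderiv ℝ Φ (E4.ofTimeSpace (u + F y) y) (E4.basisVector μ) ^ 2)) + (∫⁻ y in {y : E3 | 2 * M < ‖y‖}, ENNReal.ofReal (∑ μ : Fin 4, fderiv ℝ Φ (E4.ofTimeSpace (0 + F y) y) (E4.basisVector μ)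 ^ 2)) + (∫⁻ y in {y : E3 | 2 * M < ‖y‖}, ENNReal.ofReal (∑ μ : Fin 4, fderiv ℝ Φ (E4.ofTimeSpace (s + F y) y) (E4.basisVector μ) ^ 2)) + (∫⁻ y in {y : E3 | 2 * M < ‖y‖ ∧ ‖y‖ ≤ 9 * M}, ENNReal.ofReal (Φ (E4.ofTimeSpace (0 + F y) y) ^ 2)) + (∫⁻ y in {y : E3 | 2 * M < ‖y‖ ∧ ‖y‖ ≤ 9 * M}, ENNReal.ofReal (Φ (E4.ofTimeSpace (s + F y) y) ^ 2))) := by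
  intro M η hM hη hη4
  obtain ⟨K₀, hR0⟩ := restFrame_zerothOrder_le M hM
  obtain ⟨K₂, hR2⟩ := restFrame_photonSphere_timeDeriv_le M hM
  obtain ⟨K₃, hR3⟩ := restFrame_photonSphere_angular_le M hM
  obtain ⟨KP, hKP0, hP⟩ := morawetzBulk_dominates M η (9 * M) hM hη
  set m : ℝ≥0∞ := ENNReal.ofReal M with hm
  set mi : ℝ≥0∞ := ENNReal.ofReal M⁻¹ with hmi
  set m2 : ℝ≥0∞ := ENNReal.ofReal (M ^ 2) with hm2
  set mi2 : ℝ≥0∞ := ENNReal.ofReal (M ^ 2)⁻¹ with hmi2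
  set kp : ℝ≥0∞ := ENNReal.ofReal KP with hkp
  set kW : ℝ≥0∞ := ENNReal.ofReal (KP * (M ^ 2 + M ^ 3)) with hkW
  set kF : ℝ≥0∞ := ENNReal.ofReal (KP * M ^ 3) with hkF
  set CG : ℝ≥0∞ := (K₂ : ℝ≥0∞) * (m + m + kp + kW) with hCG
  set CY : ℝ≥0∞ := 1 + kp + CG with hCY
  set CZ : ℝ≥0∞ := (K₀ : ℝ≥0∞) * (m + m + kF + m2 * (kp + CY)) with hCZ
  set CA : ℝ≥0∞ := (K₃ : ℝ≥0∞) * ((m + mi) + (m + mi) + (CG + kp + mi2 * CZ)) with hCA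
  set Ktot : ℝ≥0∞ := 51 * CG + CA + ENNReal.ofReal (50 * KP) with hKtot
  have hKfin : Ktot ≠ ⊤ := by simp only [hKtot, hCA, hCZ, hCY, hCG, hm, hmi, hm2, hmi2, hkp, hkW, hkF]; finiteness
  refine ⟨Ktot.toNNReal, ?_⟩
  intro F Φ s hF hdF hΦ hsol hs
  rw [ENNReal.coe_toNNReal hKfin]
  set Φd : E4 → ℝ := fun z ↦ fderiv ℝ Φ z (E4.basisVector 0) with hΦd
  set L : ℝ → E3 → E4 := fun u y ↦ E4.ofTimeSpace (u + F y) y with hL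
  have hΦ2 : ContDiff ℝ 2 Φ := hΦ.of_le (by norm_num)
  have hΦ1 : ContDiff ℝ 1 Φ := hΦ.of_le (by norm_num)
  have hΦd2 : ContDiff ℝ 2 Φd := (hΦ.fderiv_right (m := 2) (by norm_num)).clm_apply contDiff_const
  have hdiffΦ : ∀ x, DifferentiableAt ℝ Φ x := fun x ↦ hΦ1.differentiable one_ne_zero x
  have hdiffΦd : ∀ x, DifferentiableAt ℝ Φd x := fun x ↦
    (hΦd2.differentiable (by norm_num)) x
  have hrad : ∀ u y, Kerr.radius 0 (L u y) = ‖y‖ := fun u y ↦ by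
    simp only [hL, Kerr.radius_zero_left, E4.spatialNorm_ofTimeSpace]
  -- the seven atoms of the right-hand side
  set DΦ : ℝ≥0∞ := ∫⁻ u in Set.Ioc 0 s, ∫⁻ y in {y : E3 | 2 * M < ‖y‖}, ENNReal.ofReal ((fun (x : E4) ↦ (((Kerr.radius 0 x - 2 * M) * M ^ 3 * (Kerr.radius 0 x - 3 * M) ^ 2 / (2 * Kerr.radius 0 x ^ 7)) * fderiv ℝ Φ x (E4.basisVector 0) ^ 2 + (3 * M / (20 * Kerr.radius 0 x ^ 2)) * ((1 - (Real.smoothTransition (2 - Kerr.radius 0 x / (8 * M)) * (2 * Kerr.scalarH M 0 x))) * (∑ i : Fin 3, x i.succ * fderiv ℝ Φ x (E4.basisVector i.succ)) / Kerr.radius 0 x + (Real.smoothTransition (2 - Kerr.radius 0 x / (8 * M)) * (2 * Kerr.scalarH M 0 x)) * fderiv ℝ Φ x (E4.basisVector 0)) ^ 2 + ((Kerr.radius 0 x - 3 * M) ^ 2 / (8 * Kerr.radius 0 x ^ 3)) * ((∑ i : Fin 3, fderiv ℝ Φ x (E4.basisVector i.succ) ^ 2) - ((∑ i : Fin 3,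 x i.succ * fderiv ℝ Φ x (E4.basisVector i.succ)) / Kerr.radius 0 x) ^ 2) + (if 7 * M ≤ Kerr.radius 0 x then M * (Kerr.radius 0 x - 7 * M) / (4 * Kerr.radius 0 x ^ 5) else 0) * Φ x ^ 2)) (E4.ofTimeSpace (u + F y) y)) with hDΦ
  set DΦd : ℝ≥0∞ := ∫⁻ u in Set.Ioc 0 s, ∫⁻ y in {y : E3 | 2 * M < ‖y‖}, ENNReal.ofReal ((fun (x : E4) ↦ (((Kerr.radius 0 x - 2 * M) * M ^ 3 * (Kerr.radius 0 x - 3 * M) ^ 2 / (2 * Kerr.radius 0 x ^ 7)) * fderiv ℝ (fun z ↦ fderiv ℝ Φ z (E4.basisVector 0)) x (E4.basisVector 0) ^ 2 + (3 * M / (20 * Kerr.radius 0 x ^ 2)) * ((1 - (Real.smoothTransition (2 - Kerr.radius 0 x / (8 * M)) * (2 * Kerr.scalarH M 0 x))) * (∑ i : Fin 3, x i.succ * fderiv ℝ (fun z ↦ fderiv ℝ Φ z (E4.basisVector 0)) x (E4.basisVector i.succ)) / Kerr.radius 0 x + (Real.smoothTransition (2 - Kerr.radius 0 x / (8 * M))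 * (2 * Kerr.scalarH M 0 x)) * fderiv ℝ (fun z ↦ fderiv ℝ Φ z (E4.basisVector 0)) x (E4.basisVector 0)) ^ 2 + ((Kerr.radius 0 x - 3 * M) ^ 2 / (8 * Kerr.radius 0 x ^ 3)) * ((∑ i : Fin 3, fderiv ℝ (fun z ↦ fderiv ℝ Φ z (E4.basisVector 0)) x (E4.basisVector i.succ) ^ 2) - ((∑ i : Fin 3, x i.succ * fderiv ℝ (fun z ↦ fderiv ℝ Φ z (E4.basisVector 0)) x (E4.basisVector i.succ)) / Kerr.radius 0 x) ^ 2) + (if 7 * M ≤ Kerr.radius 0 x then M * (Kerr.radius 0 x - 7 * M) / (4 * Kerr.radius 0 x ^ 5) else 0) * (fun z ↦ fderiv ℝ Φ z (E4.basisVector 0)) x ^ 2)) (E4.ofTimeSpace (u + F y) y)) with hDΦd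
  set COLe : ℝ≥0∞ := ∫⁻ u in Set.Ioc 0 s, ∫⁻ y in {y : E3 | 2 * M < ‖y‖ ∧ ‖y‖ < 2 * M + η}, ENNReal.ofReal (∑ μ : Fin 4, fderiv ℝ Φ (E4.ofTimeSpace (u + F y) y) (E4.basisVector μ) ^ 2) with hCOLe
  set E0 : ℝ≥0∞ := ∫⁻ y in {y : E3 | 2 * M < ‖y‖}, ENNReal.ofReal (∑ μ : Fin 4, fderiv ℝ Φ (E4.ofTimeSpace (0 + F y) y) (E4.basisVector μ) ^ 2) with hE0
  set Es : ℝ≥0∞ := ∫⁻ y in {y : E3 | 2 * M < ‖y‖}, ENNReal.ofReal (∑ μ : Fin 4, fderiv ℝ Φ (E4.ofTimeSpace (s + F y) y) (E4.basisVector μ) ^ 2) with hEs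
  set P0 : ℝ≥0∞ := ∫⁻ y in {y : E3 | 2 * M < ‖y‖ ∧ ‖y‖ ≤ 9 * M}, ENNReal.ofReal (Φ (E4.ofTimeSpace (0 + F y) y) ^ 2) with hP0
  set Ps : ℝ≥0∞ := ∫⁻ y in {y : E3 | 2 * M < ‖y‖ ∧ ‖y‖ ≤ 9 * M}, ENNReal.ofReal (Φ (E4.ofTimeSpace (s + F y) y) ^ 2) with hPs
  set RHS : ℝ≥0∞ := DΦ + DΦd + COLe + E0 + Es + P0 + Ps with hRHS
  have aDΦ : DΦ ≤ RHS := le_add_right (le_add_right (le_add_right (le_add_right (le_add_right le_self_add))))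
  have aDΦd : DΦd ≤ RHS := le_add_right (le_add_right (le_add_right (le_add_right (le_add_right le_add_self))))
  have aCOL : COLe ≤ RHS := le_add_right (le_add_right (le_add_right (le_add_right le_add_self)))
  have aE0 : E0 ≤ RHS := le_add_right (le_add_right (le_add_right le_add_self))
  have aEs : Es ≤ RHS := le_add_right (le_add_right le_add_self)
  have aP0 : P0 ≤ RHS := le_add_right le_add_self
  have aPs : Ps ≤ RHS := le_add_self
  set prof : E4 → ℝ := fun x ↦ Real.smoothTransition (2 - Kerr.radius 0 x / (8 * M)) * (2 * Kerr.scalarH M 0 x) with hprof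
  set fe : E4 → ℝ := fun x ↦ ∑ μ : Fin 4, fderiv ℝ Φ x (E4.basisVector μ) ^ 2 with hfe
  set fg : E4 → ℝ := fun x ↦ fderiv ℝ Φ x (E4.basisVector 0) ^ 2 with hfg
  set fsq : E4 → ℝ := fun x ↦ Φ x ^ 2 with hfsq
  set fS : (E4 → ℝ) → E4 → ℝ := fun f x ↦ ∑ i : Fin 3, x i.succ * fderiv ℝ f x (E4.basisVector i.succ) with hfS
  set frs : (E4 → ℝ) → E4 → ℝ := fun f x ↦
    ((1 - prof x) * fS f x / Kerr.radius 0 x + prof x * fderiv ℝ f x (E4.basisVector 0)) ^ 2 with hfrs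
  set fang : E4 → ℝ := fun x ↦ (∑ i : Fin 3, fderiv ℝ Φ x (E4.basisVector i.succ) ^ 2) -
    (fS Φ x / Kerr.radius 0 x) ^ 2 with hfang
  set fB : (E4 → ℝ) → E4 → ℝ := fun f x ↦
    ((Kerr.radius 0 x - 2 * M) * M ^ 3 * (Kerr.radius 0 x - 3 * M) ^ 2 / (2 * Kerr.radius 0 x ^ 7)) *
      fderiv ℝ f x (E4.basisVector 0) ^ 2 +
    (3 * M / (20 * Kerr.radius 0 x ^ 2)) *
      ((1 - prof x) * fS f x / Kerr.radius 0 x + prof x * fderiv ℝ f x (E4.basisVector 0)) ^ 2 +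
    ((Kerr.radius 0 x - 3 * M) ^ 2 / (8 * Kerr.radius 0 x ^ 3)) *
      ((∑ i : Fin 3, fderiv ℝ f x (E4.basisVector i.succ) ^ 2) - (fS f x / Kerr.radius 0 x) ^ 2) +
    (if 7 * M ≤ Kerr.radius 0 x then M * (Kerr.radius 0 x - 7 * M) / (4 * Kerr.radius 0 x ^ 5) else 0) *
      f x ^ 2 with hfB
  have hcfd : Continuous (fderiv ℝ Φ) := hΦ1.continuous_fderiv one_ne_zero
  have hcapp : ∀ (v : E4), Continuous fun x ↦ fderiv ℝ Φ x v := fun v ↦ hcfd.clm_apply continuous_const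
  have hccoord : ∀ (i : Fin 4), Continuous fun x : E4 ↦ x i := fun i ↦ (EuclideanSpace.proj i).continuous
  have hcrad : Continuous (Kerr.radius 0) := Kerr.continuous_radius 0
  have hfe_c : Continuous fe := by simp only [hfe]; fun_prop
  have hfg_c : Continuous fg := by simp only [hfg]; fun_prop
  have hfsq_c : Continuous fsq := by simp only [hfsq]; exact (hΦ.continuous).pow 2
  have hfS_c : Continuous (fS Φ) := by
    simp only [hfS]
    exact continuous_finsetSum _ fun i _ ↦ (hccoord i.succ).mul (hcapp _)
  have hfang_m : Measurable fang := by
    simp only [hfang]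
    refine Measurable.sub ?_ ?_
    · exact (continuous_finsetSum _ fun i _ ↦ (hcapp _).pow 2).measurable
    · exact (hfS_c.measurable.div hcrad.measurable).pow_const 2
  have hLc : Continuous (Function.uncurry L) := by
    simp only [hL]
    exact E4.continuous_ofTimeSpace_uncurry.comp
      ((continuous_fst.add (hF.continuous.comp continuous_snd)).prodMk continuous_snd)
  have hLcu : ∀ u, Continuous (L u) := fun u ↦ hLc.comp (Continuous.prodMk_right u)
  -- measurability of the slab integrands we split
  have meas_of : ∀ {f : E4 → ℝ}, Measurable f →
      Measurable (fun p : ℝ × E3 ↦ ENNReal.ofReal (f (L p.1 p.2))) ∧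
      ∀ u, Measurable (fun y : E3 ↦ ENNReal.ofReal (f (L u y))) := by
    intro f hf
    refine ⟨ENNReal.measurable_ofReal.comp (hf.comp hLc.measurable), fun u ↦ ?_⟩
    exact ENNReal.measurable_ofReal.comp (hf.comp (hLcu u).measurable)
  set PS : Set E3 := {y : E3 | 5 * M / 2 ≤ ‖y‖ ∧ ‖y‖ ≤ 7 * M / 2} with hPS
  set SH : Set E3 := {y : E3 | 9 * M / 4 ≤ ‖y‖ ∧ ‖y‖ ≤ 15 * M / 4} with hSH
  set SHL : Set E3 := {y : E3 | (9 * M / 4 ≤ ‖y‖ ∧ ‖y‖ ≤ 5 * M / 2) ∨ (7 * M / 2 ≤ ‖y‖ ∧ ‖y‖ ≤ 15 * M / 4)} with hSHL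
  set Ω : Set E3 := {y : E3 | 2 * M < ‖y‖} with hΩ
  set Ω9 : Set E3 := {y : E3 | 2 * M < ‖y‖ ∧ ‖y‖ ≤ 9 * M} with hΩ9
  set Zs : Set E3 := {y : E3 | 2 * M < ‖y‖ ∧ ‖y‖ ≤ 15 * M / 2} with hZs
  set FAR : Set E3 := {y : E3 | 15 * M / 2 ≤ ‖y‖ ∧ ‖y‖ ≤ 9 * M} with hFAR
  set COL : Set E3 := {y : E3 | 2 * M < ‖y‖ ∧ ‖y‖ < 2 * M + η} with hCOL
  set OFF : Set E3 := {y : E3 | 2 * M + η ≤ ‖y‖ ∧ ‖y‖ ≤ 9 * M ∧ (‖y‖ ≤ 5 * M / 2 ∨ 7 * M / 2 ≤ ‖y‖)} with hOFF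
  have mPS : MeasurableSet PS := measurableSet_norm_Icc _ _
  have mSH : MeasurableSet SH := measurableSet_norm_Icc _ _
  have mΩ9 : MeasurableSet Ω9 := measurableSet_norm_Ioc _ _
  have mFAR : MeasurableSet FAR := measurableSet_norm_Icc _ _
  have mOFF : MeasurableSet OFF := by
    simp only [hOFF]
    refine (isClosed_le continuous_const continuous_norm).measurableSet.inter
      ((isClosed_le continuous_norm continuous_const).measurableSet.inter ?_)
    exact (isClosed_le continuous_norm continuous_const).measurableSet.union
      (isClosed_le continuous_const continuous_norm).measurableSet
  have mSHL : MeasurableSet SHL := measurableSet_norm_Icc_union _ _ _ _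
  obtain ⟨sub_PS_Ω, sub_PS_Ω9, sub_SH_Ω, sub_SH_Ω9, sub_SH_Zs, sub_FAR_Ω, sub_OFF_Ω, sub_SHL_OFF,
    sub_Ω9_Ω, SH_eq, Ω9_sub⟩ := photonSphere_shells M η hM hη hη4
  set SI : Set E3 → (ℝ → E3 → ℝ≥0∞) → ℝ≥0∞ := fun S f ↦ ∫⁻ u in Set.Ioc 0 s, ∫⁻ y in S, f u y with hSI
  set ie : ℝ → E3 → ℝ≥0∞ := fun u y ↦ ENNReal.ofReal (fe (L u y)) with hie
  set ig : ℝ → E3 → ℝ≥0∞ := fun u y ↦ ENNReal.ofReal (fg (L u y)) with hig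
  set isq : ℝ → E3 → ℝ≥0∞ := fun u y ↦ ENNReal.ofReal (fsq (L u y)) with hisq
  set iang : ℝ → E3 → ℝ≥0∞ := fun u y ↦ ENNReal.ofReal (fang (L u y)) with hiang
  set irs : ℝ → E3 → ℝ≥0∞ := fun u y ↦ ENNReal.ofReal (frs Φ (L u y)) with hirs
  set iB : ℝ → E3 → ℝ≥0∞ := fun u y ↦ ENNReal.ofReal (fB Φ (L u y)) with hiB
  set iBd : ℝ → E3 → ℝ≥0∞ := fun u y ↦ ENNReal.ofReal (fB Φd (L u y)) with hiBd
  have mie : Measurable (Function.uncurry ie) := (meas_of hfe_c.measurable).1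
  have mig : Measurable (Function.uncurry ig) := (meas_of hfg_c.measurable).1
  have miang : Measurable (Function.uncurry iang) := (meas_of hfang_m).1
  -- the right-hand side atoms in this notation
  have eDΦ : DΦ = SI Ω iB := rfl
  have eDΦd : DΦd = SI Ω iBd := rfl
  have eCOLe : COLe = SI COL ie := rfl
  have hμ : ∀ x, 0 ≤ prof x ∧ prof x ≤ 2 * M / Kerr.radius 0 x := fun x ↦
    morawetzBulk_profile_bounds hM x
  have pw_g_le_e : ∀ x, fg x ≤ fe x := by
    intro x
    simp only [hfg, hfe]
    exact Finset.single_le_sum (f := fun μ : Fin 4 ↦ fderiv ℝ Φ x (E4.basisVector μ) ^ 2)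
      (fun μ _ ↦ sq_nonneg _) (Finset.mem_univ 0)
  have pw1 : ∀ x, 5 * M / 2 ≤ Kerr.radius 0 x → Kerr.radius 0 x ≤ 7 * M / 2 →
      fe x ≤ 51 * fg x + fang x + 50 * frs Φ x := by
    intro x h1 _h2
    have hr0 : 0 < Kerr.radius 0 x := by linarith
    have h := photonSphere_energy_split_real (T := fderiv ℝ Φ x (E4.basisVector 0)) (S := fS Φ x)
      (A := ∑ i : Fin 3, fderiv ℝ Φ x (E4.basisVector i.succ) ^ 2) h1 hr0 (hμ x).1 (hμ x).2
    have hfe' : fe x = fderiv ℝ Φ x (E4.basisVector 0) ^ 2 +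
        ∑ i : Fin 3, fderiv ℝ Φ x (E4.basisVector i.succ) ^ 2 := by
      simp only [hfe, Fin.sum_univ_succ]
    rw [hfe']
    exact h
  -- instances of `morawetzBulk_dominates`
  have hP1 : ∀ x, 2 * M + η ≤ Kerr.radius 0 x → Kerr.radius 0 x ≤ 9 * M →
      (Kerr.radius 0 x ≤ 5 * M / 2 ∨ 7 * M / 2 ≤ Kerr.radius 0 x) → fe x ≤ KP * fB Φ x :=
    fun x h1 h2 h3 ↦ (hP Φ x (hdiffΦ x)).1 h1 h2 h3
  have hP2 : ∀ x, 2 * M < Kerr.radius 0 x → Kerr.radius 0 x ≤ 9 * M → frs Φ x ≤ KP * fB Φ x :=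
    fun x h1 h2 ↦ (hP Φ x (hdiffΦ x)).2.1 h1 h2
  have hP2d : ∀ x, 2 * M < Kerr.radius 0 x → Kerr.radius 0 x ≤ 9 * M → frs Φd x ≤ KP * fB Φd x :=
    fun x h1 h2 ↦ (hP Φd x (hdiffΦd x)).2.1 h1 h2
  have hP3d : ∀ x, 9 * M / 4 ≤ Kerr.radius 0 x → Kerr.radius 0 x ≤ 15 * M / 4 →
      (Kerr.radius 0 x - 3 * M) ^ 2 * fderiv ℝ Φd x (E4.basisVector 0) ^ 2 ≤ KP * M ^ 3 * fB Φd x :=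
    fun x h1 h2 ↦ (hP Φd x (hdiffΦd x)).2.2.1 h1 h2
  have hP4 : ∀ x, 15 * M / 2 ≤ Kerr.radius 0 x → Kerr.radius 0 x ≤ 9 * M → Φ x ^ 2 ≤ KP * M ^ 3 * fB Φ x :=
    fun x h1 h2 ↦ (hP Φ x (hdiffΦ x)).2.2.2 h1 h2
  have mΩ : MeasurableSet Ω := measurableSet_norm_Ioi _
  have mCOL : MeasurableSet COL := measurableSet_norm_Ioo _ _
  have ofReal_le_mul : ∀ {a b c : ℝ}, 0 ≤ c → a ≤ c * b →
      ENNReal.ofReal a ≤ ENNReal.ofReal c * ENNReal.ofReal b := fun hc h ↦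
    (ENNReal.ofReal_le_ofReal h).trans_eq (ENNReal.ofReal_mul hc)
  have C1 : ∀ t, ∫⁻ y in Ω, ig t y ≤ ∫⁻ y in Ω, ie t y := fun t ↦
    setLIntegral_mono' mΩ fun y _ ↦ ENNReal.ofReal_le_ofReal (pw_g_le_e _)
  have hCOLg : SI COL ig ≤ COLe := eCOLe ▸ slab_lintegral_mono_fun mCOL fun u y _ ↦ ENNReal.ofReal_le_ofReal (pw_g_le_e _)
  have hOFF : SI OFF ig ≤ kp * DΦ := by
    calc SI OFF ig ≤ SI OFF (fun u y ↦ kp * iB u y) := by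
          refine slab_lintegral_mono_fun mOFF fun u y hy ↦ ?_
          simp only [hOFF, Set.mem_setOf_eq] at hy
          have hr := hrad u y
          refine ofReal_le_mul hKP0 ((pw_g_le_e _).trans (hP1 _ ?_ ?_ ?_))
          · rw [hr]; exact hy.1
          · rw [hr]; exact hy.2.1
          · rw [hr]; exact hy.2.2
      _ = kp * SI OFF iB := slab_lintegral_const_mul _ ENNReal.ofReal_ne_top
      _ ≤ kp * DΦ := by rw [eDΦ]; exact mul_le_mul_right (slab_lintegral_mono_set iB sub_OFF_Ω) _
  have hSHLg : SI SHL ig ≤ kp * DΦ := (slab_lintegral_mono_set ig sub_SHL_OFF).trans hOFF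
  have hW : SI SH (fun u y ↦ ENNReal.ofReal (M ^ 2 * frs Φd (L u y) +
      (‖y‖ - 3 * M) ^ 2 * fderiv ℝ Φd (L u y) (E4.basisVector 0) ^ 2)) ≤ kW * DΦd := by
    calc SI SH (fun u y ↦ ENNReal.ofReal (M ^ 2 * frs Φd (L u y) +
          (‖y‖ - 3 * M) ^ 2 * fderiv ℝ Φd (L u y) (E4.basisVector 0) ^ 2))
          ≤ SI SH (fun u y ↦ kW * iBd u y) := by
          refine slab_lintegral_mono_fun mSH fun u y hy ↦ ?_
          simp only [hSH, Set.mem_setOf_eq] at hy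
          have hr := hrad u y
          have h9 : 2 * M < Kerr.radius 0 (L u y) := by rw [hr]; linarith [hy.1]
          have h9' : Kerr.radius 0 (L u y) ≤ 9 * M := by rw [hr]; linarith [hy.2]
          have ha := hP2d _ h9 h9'
          have hb := hP3d _ (by rw [hr]; exact hy.1) (by rw [hr]; exact hy.2)
          refine ofReal_le_mul (by positivity) ?_
          rw [← hr]
          exact commutedBulk_real (M := M) (KP := KP) ha hb
      _ = kW * SI SH iBd := slab_lintegral_const_mul _ ENNReal.ofReal_ne_top
      _ ≤ kW * DΦd := by rw [eDΦd]; exact mul_le_mul_right (slab_lintegral_mono_set iBd sub_SH_Ω) _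
  have h2' : SI PS ig ≤ (K₂ : ℝ≥0∞) * (m * (∫⁻ y in Ω, ig 0 y) + m * (∫⁻ y in Ω, ig s y) +
      SI SHL ig + SI SH (fun u y ↦ ENNReal.ofReal (M ^ 2 * frs Φd (L u y) +
        (‖y‖ - 3 * M) ^ 2 * fderiv ℝ Φd (L u y) (E4.basisVector 0) ^ 2))) :=
    hR2 F Φ s hF hdF hΦ2 hs
  have hG : SI PS ig ≤ CG * RHS := by
    calc SI PS ig ≤ _ := h2'
      _ ≤ (K₂ : ℝ≥0∞) * (m * E0 + m * Es + kp * DΦ + kW * DΦd) :=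
          mul_le_mul_right (add_le_add (add_le_add (add_le_add (mul_le_mul_right (C1 0) _)
            (mul_le_mul_right (C1 s) _)) hSHLg) hW) _
      _ ≤ (K₂ : ℝ≥0∞) * (m * RHS + m * RHS + kp * RHS + kW * RHS) :=
          mul_le_mul_right (add_le_add (add_le_add (add_le_add (mul_le_mul_right aE0 _)
            (mul_le_mul_right aEs _)) (mul_le_mul_right aDΦ _)) (mul_le_mul_right aDΦd _)) _
      _ = CG * RHS := by simp only [hCG]; ring
  have hY : SI Ω9 ig ≤ CY * RHS := by
    calc SI Ω9 ig ≤ SI (COL ∪ (OFF ∪ PS)) ig := slab_lintegral_mono_set ig Ω9_sub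
      _ ≤ SI COL ig + SI (OFF ∪ PS) ig := slab_lintegral_union_le _ _ mig
      _ ≤ SI COL ig + (SI OFF ig + SI PS ig) := add_le_add le_rfl (slab_lintegral_union_le _ _ mig)
      _ ≤ COLe + (kp * DΦ + CG * RHS) := add_le_add hCOLg (add_le_add hOFF hG)
      _ ≤ RHS + (kp * RHS + CG * RHS) := add_le_add aCOL (add_le_add (mul_le_mul_right aDΦ _) le_rfl)
      _ = CY * RHS := by simp only [hCY]; ring
  have h0' : SI Zs isq ≤ (K₀ : ℝ≥0∞) * (m * (∫⁻ y in Ω9, isq 0 y) + m * (∫⁻ y in Ω9, isq s y) +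
      SI FAR isq + m2 * SI Ω9 (fun u y ↦ ENNReal.ofReal (frs Φ (L u y) + fg (L u y)))) :=
    hR0 F Φ s hF hdF hΦ1 hs
  have hFAR : SI FAR isq ≤ kF * DΦ := by
    calc SI FAR isq ≤ SI FAR (fun u y ↦ kF * iB u y) := by
          refine slab_lintegral_mono_fun mFAR fun u y hy ↦ ?_
          simp only [hFAR, Set.mem_setOf_eq] at hy
          have hr := hrad u y
          exact ofReal_le_mul (by positivity) (hP4 _ (by rw [hr]; exact hy.1) (by rw [hr]; exact hy.2))
      _ = kF * SI FAR iB := slab_lintegral_const_mul _ ENNReal.ofReal_ne_top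
      _ ≤ kF * DΦ := by rw [eDΦ]; exact mul_le_mul_right (slab_lintegral_mono_set iB sub_FAR_Ω) _
  have hirs : SI Ω9 irs ≤ kp * DΦ := by
    calc SI Ω9 irs ≤ SI Ω9 (fun u y ↦ kp * iB u y) := by
          refine slab_lintegral_mono_fun mΩ9 fun u y hy ↦ ?_
          simp only [hΩ9, Set.mem_setOf_eq] at hy
          have hr := hrad u y
          exact ofReal_le_mul hKP0 (hP2 _ (by rw [hr]; exact hy.1) (by rw [hr]; exact hy.2))
      _ = kp * SI Ω9 iB := slab_lintegral_const_mul _ ENNReal.ofReal_ne_top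
      _ ≤ kp * DΦ := by rw [eDΦ]; exact mul_le_mul_right (slab_lintegral_mono_set iB sub_Ω9_Ω) _
  have hsumZ : SI Ω9 (fun u y ↦ ENNReal.ofReal (frs Φ (L u y) + fg (L u y))) ≤ kp * DΦ + CY * RHS := by
    calc SI Ω9 (fun u y ↦ ENNReal.ofReal (frs Φ (L u y) + fg (L u y)))
          ≤ SI Ω9 (fun u y ↦ irs u y + ig u y) :=
          slab_lintegral_mono_fun mΩ9 fun u y _ ↦ ENNReal.ofReal_add_le
      _ = SI Ω9 irs + SI Ω9 ig := slab_lintegral_add_right _ mig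
      _ ≤ kp * DΦ + CY * RHS := add_le_add hirs hY
  have hZ : SI Zs isq ≤ CZ * RHS := by
    calc SI Zs isq ≤ _ := h0'
      _ ≤ (K₀ : ℝ≥0∞) * (m * P0 + m * Ps + kF * DΦ + m2 * (kp * DΦ + CY * RHS)) :=
          mul_le_mul_right (add_le_add (add_le_add (add_le_add le_rfl le_rfl) hFAR)
            (mul_le_mul_right hsumZ _)) _
      _ ≤ (K₀ : ℝ≥0∞) * (m * RHS + m * RHS + kF * RHS + m2 * (kp * RHS + CY * RHS)) :=
          mul_le_mul_right (add_le_add (add_le_add (add_le_add (mul_le_mul_right aP0 _)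
            (mul_le_mul_right aPs _)) (mul_le_mul_right aDΦ _))
            (mul_le_mul_right (add_le_add (mul_le_mul_right aDΦ _) le_rfl) _)) _
      _ = CZ * RHS := by simp only [hCZ]; ring
  have h3' : SI PS iang ≤ (K₃ : ℝ≥0∞) *
      ((∫⁻ y in SH, ENNReal.ofReal (M * fe (L 0 y) + fsq (L 0 y) / M)) +
       (∫⁻ y in SH, ENNReal.ofReal (M * fe (L s y) + fsq (L s y) / M)) +
       SI SH (fun u y ↦ ENNReal.ofReal (fg (L u y) + fsq (L u y) / M ^ 2))) :=
    hR3 F Φ s hF hdF hΦ2 hsol hs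
  have hLT : ∀ t, (∫⁻ y in SH, ENNReal.ofReal (M * fe (L t y) + fsq (L t y) / M)) ≤
      m * (∫⁻ y in Ω, ie t y) + mi * (∫⁻ y in Ω9, isq t y) := by
    intro t
    have hmeas : Measurable fun y ↦ m * ie t y :=
      ((meas_of hfe_c.measurable).2 t).const_mul m
    calc (∫⁻ y in SH, ENNReal.ofReal (M * fe (L t y) + fsq (L t y) / M))
        ≤ ∫⁻ y in SH, (m * ie t y + mi * isq t y) := by
          refine setLIntegral_mono' mSH fun y _ ↦ ?_
          refine ENNReal.ofReal_add_le.trans (add_le_add ?_ ?_)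
          · rw [hm, ← ENNReal.ofReal_mul hM.le]
          · rw [hmi, ← ENNReal.ofReal_mul (inv_nonneg.mpr hM.le), div_eq_inv_mul]
      _ = m * (∫⁻ y in SH, ie t y) + mi * (∫⁻ y in SH, isq t y) := by
          rw [lintegral_add_left hmeas, lintegral_const_mul' m _ ENNReal.ofReal_ne_top,
            lintegral_const_mul' mi _ ENNReal.ofReal_ne_top]
      _ ≤ m * (∫⁻ y in Ω, ie t y) + mi * (∫⁻ y in Ω9, isq t y) :=
          add_le_add (mul_le_mul_right (lintegral_mono_set sub_SH_Ω) _)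
            (mul_le_mul_right (lintegral_mono_set sub_SH_Ω9) _)
  have hSHsub : SH ⊆ PS ∪ SHL := by simp only [hSH, hPS, hSHL]; exact SH_eq.le
  have hSHg : SI SH ig ≤ CG * RHS + kp * DΦ := by
    calc SI SH ig ≤ SI (PS ∪ SHL) ig := slab_lintegral_mono_set ig hSHsub
      _ ≤ SI PS ig + SI SHL ig := slab_lintegral_union_le _ _ mig
      _ ≤ CG * RHS + kp * DΦ := add_le_add hG hSHLg
  have hslabA : SI SH (fun u y ↦ ENNReal.ofReal (fg (L u y) + fsq (L u y) / M ^ 2)) ≤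
      (CG * RHS + kp * DΦ) + mi2 * (CZ * RHS) := by
    calc SI SH (fun u y ↦ ENNReal.ofReal (fg (L u y) + fsq (L u y) / M ^ 2))
        ≤ SI SH (fun u y ↦ ig u y + mi2 * isq u y) := by
          refine slab_lintegral_mono_fun mSH fun u y _ ↦ ?_
          refine ENNReal.ofReal_add_le.trans (add_le_add le_rfl ?_)
          rw [hmi2, ← ENNReal.ofReal_mul (inv_nonneg.mpr (by positivity)), div_eq_inv_mul]
      _ = SI SH ig + SI SH (fun u y ↦ mi2 * isq u y) := slab_lintegral_add_left _ _ _ _ mig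
      _ = SI SH ig + mi2 * SI SH isq :=
          congrArg (SI SH ig + ·) (slab_lintegral_const_mul _ ENNReal.ofReal_ne_top)
      _ ≤ (CG * RHS + kp * DΦ) + mi2 * (CZ * RHS) :=
          add_le_add hSHg (mul_le_mul_right ((slab_lintegral_mono_set isq sub_SH_Zs).trans hZ) _)
  have hA : SI PS iang ≤ CA * RHS := by
    calc SI PS iang ≤ _ := h3'
      _ ≤ (K₃ : ℝ≥0∞) * ((m * E0 + mi * P0) + (m * Es + mi * Ps) +
            ((CG * RHS + kp * DΦ) + mi2 * (CZ * RHS))) :=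
          mul_le_mul_right (add_le_add (add_le_add (hLT 0) (hLT s)) hslabA) _
      _ ≤ (K₃ : ℝ≥0∞) * ((m * RHS + mi * RHS) + (m * RHS + mi * RHS) +
            ((CG * RHS + kp * RHS) + mi2 * (CZ * RHS))) :=
          mul_le_mul_right (add_le_add (add_le_add
            (add_le_add (mul_le_mul_right aE0 _) (mul_le_mul_right aP0 _))
            (add_le_add (mul_le_mul_right aEs _) (mul_le_mul_right aPs _)))
            (add_le_add (add_le_add le_rfl (mul_le_mul_right aDΦ _)) le_rfl)) _
      _ = CA * RHS := by simp only [hCA]; ring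
  have hmeas51 : Measurable (Function.uncurry fun u y ↦ (51 : ℝ≥0∞) * ig u y) := mig.const_mul _
  have hmeas2 : Measurable (Function.uncurry fun u y ↦ (51 : ℝ≥0∞) * ig u y + iang u y) :=
    hmeas51.add miang
  have h51 : (51 : ℝ≥0∞) ≠ ⊤ := ENNReal.ofNat_ne_top
  calc SI PS ie
      ≤ SI PS (fun u y ↦ (51 : ℝ≥0∞) * ig u y + iang u y + ENNReal.ofReal (50 * KP) * iB u y) := by
        refine slab_lintegral_mono_fun mPS fun u y hy ↦ ?_
        simp only [hPS, Set.mem_setOf_eq] at hy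
        have hr := hrad u y
        have h1 : 5 * M / 2 ≤ Kerr.radius 0 (L u y) := by rw [hr]; exact hy.1
        have h2 : Kerr.radius 0 (L u y) ≤ 7 * M / 2 := by rw [hr]; exact hy.2
        have hA := pw1 _ h1 h2
        have hB := hP2 _ (by linarith) (by linarith)
        have hreal : fe (L u y) ≤ 51 * fg (L u y) + fang (L u y) + (50 * KP) * fB Φ (L u y) := by
          nlinarith
        calc ie u y ≤ ENNReal.ofReal (51 * fg (L u y) + fang (L u y) + (50 * KP) * fB Φ (L u y)) :=
              ENNReal.ofReal_le_ofReal hreal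
          _ ≤ ENNReal.ofReal (51 * fg (L u y) + fang (L u y)) + ENNReal.ofReal ((50 * KP) * fB Φ (L u y)) :=
              ENNReal.ofReal_add_le
          _ ≤ ENNReal.ofReal (51 * fg (L u y)) + ENNReal.ofReal (fang (L u y)) +
                ENNReal.ofReal ((50 * KP) * fB Φ (L u y)) := add_le_add ENNReal.ofReal_add_le le_rfl
          _ = (51 : ℝ≥0∞) * ig u y + iang u y + ENNReal.ofReal (50 * KP) * iB u y := by
              rw [ENNReal.ofReal_mul (by norm_num : (0 : ℝ) ≤ 51), ENNReal.ofReal_ofNat,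
                ENNReal.ofReal_mul (by positivity : (0 : ℝ) ≤ 50 * KP)]
    _ = SI PS (fun u y ↦ (51 : ℝ≥0∞) * ig u y + iang u y) +
          SI PS (fun u y ↦ ENNReal.ofReal (50 * KP) * iB u y) := slab_lintegral_add_left _ _ _ _ hmeas2
    _ = (SI PS (fun u y ↦ (51 : ℝ≥0∞) * ig u y) + SI PS iang) +
          ENNReal.ofReal (50 * KP) * SI PS iB := by
        rw [show SI PS (fun u y ↦ (51 : ℝ≥0∞) * ig u y + iang u y) =
            SI PS (fun u y ↦ (51 : ℝ≥0∞) * ig u y) + SI PS iang from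
          slab_lintegral_add_left _ _ _ _ hmeas51,
          show SI PS (fun u y ↦ ENNReal.ofReal (50 * KP) * iB u y) =
            ENNReal.ofReal (50 * KP) * SI PS iB from slab_lintegral_const_mul _ ENNReal.ofReal_ne_top]
    _ = ((51 : ℝ≥0∞) * SI PS ig + SI PS iang) + ENNReal.ofReal (50 * KP) * SI PS iB := by
        rw [show SI PS (fun u y ↦ (51 : ℝ≥0∞) * ig u y) = 51 * SI PS ig from
          slab_lintegral_const_mul _ h51]
    _ ≤ ((51 : ℝ≥0∞) * (CG * RHS) + CA * RHS) + ENNReal.ofReal (50 * KP) * RHS :=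
        add_le_add (add_le_add (mul_le_mul_right hG _) hA)
          (mul_le_mul_right ((slab_lintegral_mono_set iB sub_PS_Ω).trans (eDΦ.symm.le.trans aDΦ)) _)
    _ = Ktot * RHS := by simp only [hKtot]; ring

end Summit.FinalStateConjecture.FinalStateConjecture.Theorems
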